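import Summits.QuantumFields.YangMills.Theorems.DyadicChessboardChessboardTransferCells
import Summits.QuantumFields.YangMills.Theorems.DyadicChessboardWilsonChessboardRP
import Summits.QuantumFields.YangMills.Theorems.DyadicChessboardPlaneReflection
import Summits.QuantumFields.YangMills.Theorems.LangevinControlUVOSLegsFromFemtoAndGapStubCollar6
import Summits.QuantumFields.YangMills.Theorems.ComplexCouplingChannelContinuumLegGivenGapArrayFunctionalObs
import Summits.QuantumFields.YangMills.Theorems.LangevinControlUVOSLegsAtWeakCouplingCStubInheritTorus
import Literature.MathematicalPhysics.QuantumFieldTheory.BalabanBlockSpecification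
import HarnessLib

/-!
# Arrays control centred moments: the chessboard step on an even torus
# (helper for support `ChessboardTransfer`, stmt-QuantumFields-23370, route `DyadicChessboard`)

Route-independent.  The Wilson instance of the Fröhlich–Israel–Lieb–Simon chessboard estimate for the coherent array
of reflected centred plaquettes (engine: `WilsonChessboardRP.wilson_chessboard_integral_prod_subset_le` of width seat
w3 = Literature `chessboard_integral_prod_subset_le` + the tree's transported link reflection positivity; coherence:
`PlaneReflection.plane_torusLift_theta_swap`; cell arithmetic: `…ChessboardTransferCells`):

* ★ `abs_integral_prod_centred_le_of_array` — on `(ℤ/L)^4`, `L = N·B`, `N` even, `β ≥ 0`: if `n` centred plane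
  fields sit at base points congruent to reflected-array sites of pairwise distinct cells (parity-normalised in-cell
  positions with margin `≥ 1`) and each full reflected array has expectation `≤ A^(N^4)`, then
  `|E ∏ᵢ (Pᵢ − E Pᵢ)| ≤ Aⁿ`;
* `integral_prod_centred_translate` — the centred moments are invariant under a common shift of the base points;
* `abs_integral_prod_centred_le_pow` — the trivial bound `(2 C_P)ⁿ`.

References: Fröhlich–Israel–Lieb–Simon, CMP 62 (1978) Thm 4.1 (chessboard estimate) and Thm 4.3 (all lattice
hyperplanes of an even torus); Friedli–Velenik (2017) Thm 10.11; Biskup, LNM 1970 (2009) Thm 5.8.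

HONEST FRAMING: helper toward the support item `ChessboardTransfer` (stmt-QuantumFields-23370) of route
`DyadicChessboard` (planner ym-idea-11 g9, LINE 1); the crux K1 `DyadicArrayCeiling` stays OPEN; no crux, no rung
(R2a is a RECORD rung) and no summit is proved, and the Yang–Mills mass gap is NOT proved by any of this.
Cell `ym-idea-1`, width seat `ym-line-sfw-p2-w5` g12 (free hands).  THEOREMS ONLY, definition-free.
-/

set_option autoImplicit false

noncomputable section

namespace Summit.QuantumFields.YangMills.Theorems.DyadicChessboard.Transfer

open MeasureTheory
open Literature.MathematicalPhysics.QuantumFieldTheory Literature.MathematicalPhysics.QuantumLattice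
open Literature.Barriers.CriticalPhenomena.NonGibbs (BlockIdx cellReflect halfPlus cellReflect_apply mem_halfPlus)
open Summit.QuantumFields.YangMills.Cruxes.OSLegsFromFemtoAndGap.DlrCollarTransfer (plane exists_abs_plane_le)
open Summit.QuantumFields.YangMills.Theorems.FiniteSusceptibilityWeakCoupling.RPCauchySchwarz
  (theta_theta measurable_theta map_theta)
open Summit.QuantumFields.YangMills.Theorems.ContinuumLegGivenGap
  (plaquetteObs_torusLift_congr dependsOn_plaquetteObs_torusLift continuous_plaquetteObs_torusLift)
open Summit.QuantumFields.YangMills.Theorems.DyadicChessboard.Cells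
open Summit.QuantumFields.YangMills.Theorems.DyadicChessboard.WilsonChessboardRP
  (wilson_chessboard_integral_prod_subset_le wilson_rp_comap measurable_comap_restrict_of_dependsOn)
open Summit.QuantumFields.YangMills.Theorems.DyadicChessboard.PlaneReflection (plane_torusLift_theta_swap)

variable {G : Type} [Group G] [TopologicalSpace G] [IsTopologicalGroup G] [CompactSpace G]
  [MeasurableSpace G] [BorelSpace G] (r : LatticeRep G)

omit [IsTopologicalGroup G] [CompactSpace G] [BorelSpace G] in
/-- Torus aliasing of the plane fields read through the periodic lift: congruent base points give the same
function of the torus configuration. [folklore] -/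
theorem plane_torusLift_congr (L : ℕ) (q : Fin 4 × Fin 4) {y y' : Fin 4 → ℤ}
    (h : ∀ j, ((y j : ℤ) : ZMod L) = ((y' j : ℤ) : ZMod L)) (U : GaugeConfig 4 L G) :
    plane G r q y (torusLift L U) = plane G r q y' (torusLift L U) :=
  plaquetteObs_torusLift_congr r.ρ h q.1 q.2 U

omit [IsTopologicalGroup G] [CompactSpace G] [BorelSpace G] [MeasurableSpace G] [Group G] [TopologicalSpace G] in
/-- The transported positive-time condition for the torus link below `(x, a)`, in coordinates: both endpoints
have `dir`-coordinate minus `v dir` in `[1, L/2]` (pull-back by `τ_v ∘ (swap 0 dir)_*`). [folklore] -/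
theorem isPosEdge_perm_of_window (L : ℕ) (dir a : Fin 4) (v : Site 4 L) (x : Fin 4 → ℤ)
    (h0 : 1 ≤ (((x dir : ℤ) : ZMod L) - v dir).val ∧ (((x dir : ℤ) : ZMod L) - v dir).val ≤ L / 2)
    (h1 : 1 ≤ ((((x dir : ℤ) + (if dir = a then 1 else 0) : ℤ) : ZMod L) - v dir).val ∧
      ((((x dir : ℤ) + (if dir = a then 1 else 0) : ℤ) : ZMod L) - v dir).val ≤ L / 2) :
    WilsonRP.IsPosEdge ((sitePerm (Equiv.swap 0 dir).symm ((torusEdge L (x, a)).1 - v),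
      (Equiv.swap 0 dir).symm (torusEdge L (x, a)).2) : Edge 4 L) := by
  have hσ0 : (Equiv.swap (0 : Fin 4) dir).symm.symm 0 = dir := by simp
  have hshift : ((sitePerm (Equiv.swap 0 dir).symm ((torusEdge L (x, a)).1 - v)).shift
      ((Equiv.swap 0 dir).symm (torusEdge L (x, a)).2)) 0 =
      (((x dir : ℤ) : ZMod L) - v dir) + (((if dir = a then 1 else 0 : ℤ)) : ZMod L) := by
    simp only [Site.shift, torusEdge, Pi.add_apply, sitePerm_apply, Pi.sub_apply,
      Literature.Probability.LatticeModels.Torus.proj_apply, Pi.single_apply, Equiv.symm_swap]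
    by_cases hda : dir = a
    · subst hda; simp
    · have : (0 : Fin 4) ≠ Equiv.swap 0 dir a := by
        intro h
        have := congrArg (Equiv.swap (0 : Fin 4) dir) h
        rw [Equiv.swap_apply_left, Equiv.swap_apply_self] at this
        exact hda this
      simp [hda, this]
  have hshift' : ((sitePerm (Equiv.swap 0 dir).symm ((torusEdge L (x, a)).1 - v)).shift
      ((Equiv.swap 0 dir).symm (torusEdge L (x, a)).2)) 0 =
      ((((x dir : ℤ) + (if dir = a then 1 else 0) : ℤ) : ZMod L) - v dir) := by
    rw [hshift]; push_cast; ring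
  have hbase : (sitePerm (Equiv.swap 0 dir).symm ((torusEdge L (x, a)).1 - v)) 0 =
      (((x dir : ℤ) : ZMod L) - v dir) := by
    simp only [torusEdge, sitePerm_apply, Pi.sub_apply, hσ0, Literature.Probability.LatticeModels.Torus.proj_apply]
  dsimp only [WilsonRP.IsPosEdge]
  rw [hshift', hbase]
  exact ⟨h0.1, h0.2, h1.1, h1.2⟩

/-- `[dir = a] + [dir = b] ≤ [dir = a ∨ dir = b]` for `a ≠ b` (indicator bookkeeping for plaquette corners). [folklore] -/
theorem ind_add_ind_le {dir a b : Fin 4} (hab : a ≠ b) :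
    (if dir = a then (1 : ℤ) else 0) + (if dir = b then 1 else 0) ≤ (if dir = a ∨ dir = b then 1 else 0) := by
  by_cases h1 : dir = a <;> by_cases h2 : dir = b <;> simp_all

/-- **Array ⇒ centred moments (the chessboard step).**  On the torus `(ℤ/N·B)^4` (`N` even cells of side `B` per
axis, `β ≥ 0`), let `n` centred plane fields be given at base points `Y i` lying in pairwise DISTINCT cells
`cell i`, in parity-normalised in-cell positions `p i` with margin `≥ 1` (`p + χ + 1 ≤ B`), so that `Y i` is
congruent to the reflected-array site `site i (cell i)` of K1's site formula.  If for every `i` the full reflected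
array of the `i`-th centred field has expectation `≤ A^(N^4)`, then `|E ∏ᵢ (Pᵢ − E Pᵢ)| ≤ Aⁿ`.  This is the
Fröhlich–Israel–Lieb–Simon chessboard estimate (tree: `wilson_chessboard_integral_prod_subset_le`) for the
coherent array of reflected centred plaquettes (coherence: `plane_torusLift_theta_swap` + `site_reflect_congr`;
localisation: `val_sub_boundary_pos`). [cite: FrohlichIsraelLiebSimon1978, Thm 4.1 and Thm 4.3] -/
theorem abs_integral_prod_centred_le_of_array
    {β : ℝ} (hβ : 0 ≤ β) {L N B : ℕ} [NeZero N] [NeZero L] (hL : L = N * B) (hN : Even N)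
    {n : ℕ} (q : Fin n → Fin 4 × Fin 4) (hq : ∀ i, (q i).1 < (q i).2)
    (p : Fin n → Fin 4 → ℕ)
    (hp : ∀ i k, p i k + (if k = (q i).1 ∨ k = (q i).2 then 1 else 0) + 1 ≤ B)
    (site : Fin n → (Fin 4 → ZMod N) → (Fin 4 → ℤ))
    (hsite : ∀ i c k, site i c k = (((c k).val : ℕ) : ℤ) * (B : ℤ) +
      (if Even (c k).val then (p i k : ℤ)
        else (B : ℤ) - 1 - (p i k : ℤ) - (if k = (q i).1 ∨ k = (q i).2 then 1 else 0)))
    (cell : Fin n → (Fin 4 → ZMod N)) (hcell : Function.Injective cell)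
    (Y : Fin n → Fin 4 → ℤ)
    (hY : ∀ i k, ((Y i k : ℤ) : ZMod L) = ((site i (cell i) k : ℤ) : ZMod L))
    {A : ℝ} (hA : 0 ≤ A)
    (harr : ∀ i, ∫ U, ∏ c, (plane G r (q i) (site i c) (torusLift L U) -
        ∫ V, plane G r (q i) (site i c) (torusLift L V) ∂(wilsonMeasure (d := 4) (L := L) r.ρ β))
        ∂(wilsonMeasure (d := 4) (L := L) r.ρ β) ≤ A ^ (N ^ 4)) :
    |∫ U, ∏ i, (plane G r (q i) (Y i) (torusLift L U) -
        ∫ V, plane G r (q i) (Y i) (torusLift L V) ∂(wilsonMeasure (d := 4) (L := L) r.ρ β))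
        ∂(wilsonMeasure (d := 4) (L := L) r.ρ β)| ≤ A ^ n := by
  classical
  subst hL
  haveI := r.secondCountableTopology
  set μ := wilsonMeasure (d := 4) (L := N * B) r.ρ β with hμ
  haveI : IsProbabilityMeasure μ := isProbabilityMeasure_wilsonMeasure _ r.continuous β
  -- the trivial case `n = 0`
  rcases Nat.eq_zero_or_pos n with hn | hn
  · subst hn
    simp
  haveI : Nonempty (Fin n) := ⟨⟨0, hn⟩⟩
  obtain ⟨Cp, hCp⟩ := exists_abs_plane_le r
  have hLeven : Even (N * B) := hN.mul_right B
  -- reflection data: bond hyperplane `x_dir = kb.val·B - ½`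
  set w : Fin 4 → ZMod N → (Fin 4 → ℤ) := fun dir kb => Pi.single dir ((((kb.val : ℕ) : ℤ)) * (B : ℤ) - 1)
    with hw
  set v : Fin 4 → ZMod N → Site 4 (N * B) :=
    fun dir kb => Literature.Probability.LatticeModels.Torus.proj (N * B) (w dir kb) with hv
  set π : Fin 4 → Equiv.Perm (Fin 4) := fun dir => Equiv.swap 0 dir with hπ
  set Θ : Fin 4 → ZMod N → GaugeConfig 4 (N * B) G → GaugeConfig 4 (N * B) G := fun dir kb U =>
    torusConfigShift (v dir kb) (configPerm (π dir) (GaugeConfig.timeReflect (configPerm (π dir).symm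
      (torusConfigShift (-(v dir kb)) U)))) with hΘ
  -- means and centred observables of the array
  set M : Fin n → (Fin 4 → ZMod N) → ℝ := fun i c => ∫ V, plane G r (q i) (site i c) (torusLift (N * B) V) ∂μ
    with hM
  set g : Fin n → (Fin 4 → ZMod N) → GaugeConfig 4 (N * B) G → ℝ :=
    fun i c U => plane G r (q i) (site i c) (torusLift (N * B) U) - M i c with hg
  have hw_dir : ∀ dir kb, w dir kb dir = (((kb.val : ℕ) : ℤ)) * (B : ℤ) - 1 := fun dir kb => by
    simp [hw]
  have hv_dir : ∀ dir kb, v dir kb dir = (((((kb.val : ℕ) : ℤ)) * (B : ℤ) - 1 : ℤ) : ZMod (N * B)) :=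
    fun dir kb => by
    simp [hv, hw, Literature.Probability.LatticeModels.Torus.proj_apply]
  /- (1) the reflected cell carries the mirror site (mod the torus) -/
  have hrefl : ∀ i (dir : Fin 4) (kb : ZMod N) (c : Fin 4 → ZMod N) (j : Fin 4),
      ((site i (cellReflect dir kb c) j : ℤ) : ZMod (N * B)) =
        ((Function.update (site i c) dir (2 * w dir kb dir + 1 - site i c dir -
          (if (q i).1 = dir ∨ (q i).2 = dir then 1 else 0)) j : ℤ) : ZMod (N * B)) := by
    intro i dir kb c j
    by_cases hj : j = dir
    · subst hj
      rw [Function.update_self, hw_dir, hsite, hsite, cellReflect_apply, Function.update_self]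
      have hχ : (if (q i).1 = j ∨ (q i).2 = j then (1 : ℤ) else 0) =
          (if j = (q i).1 ∨ j = (q i).2 then 1 else 0) := by
        congr 1; exact propext ⟨fun h => h.imp Eq.symm Eq.symm, fun h => h.imp Eq.symm Eq.symm⟩
      rw [hχ]
      exact site_reflect_congr hN B (c j) kb (p i j : ℤ) _
    · rw [Function.update_of_ne hj, hsite, hsite, cellReflect_apply, Function.update_of_ne hj]
  /- (2) the reflections preserve the Wilson measure; the means are reflection invariant -/
  have hΘm : ∀ dir kb, Measurable (Θ dir kb) := fun dir kb => measurable_theta (π dir) (v dir kb)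
  have hΘΘ : ∀ dir kb U, Θ dir kb (Θ dir kb U) = U := fun dir kb U => theta_theta (π dir) (v dir kb) U
  have hΘmp : ∀ dir kb, MeasurePreserving (Θ dir kb) μ μ :=
    fun dir kb => ⟨hΘm dir kb, map_theta r.ρ r.continuous β (π dir) (v dir kb)⟩
  have hΘemb : ∀ dir kb, MeasurableEmbedding (Θ dir kb) := fun dir kb =>
    (MeasurableEquiv.ofInvolutive (Θ dir kb) (hΘΘ dir kb) (hΘm dir kb)).measurableEmbedding
  have hMrefl : ∀ i dir kb c, M i (cellReflect dir kb c) = M i c := by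
    intro i dir kb c
    simp only [hM]
    calc ∫ V, plane G r (q i) (site i (cellReflect dir kb c)) (torusLift (N * B) V) ∂μ
        = ∫ V, plane G r (q i) (site i c) (torusLift (N * B) (Θ dir kb V)) ∂μ := by
          refine integral_congr_ae (Filter.Eventually.of_forall fun V => ?_)
          dsimp only
          rw [plane_torusLift_congr r (N * B) (q i) (hrefl i dir kb c) V]
          exact (plane_torusLift_theta_swap r (N * B) dir (w dir kb) (hq i) (site i c) V).symm
      _ = ∫ V, plane G r (q i) (site i c) (torusLift (N * B) V) ∂μ :=
          (hΘmp dir kb).integral_comp (hΘemb dir kb) (fun V => plane G r (q i) (site i c) (torusLift (N * B) V))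
  /- (3) coherence of the array -/
  have hgΘ : ∀ i (dir : Fin 4) (kb : ZMod N) c U, g i (cellReflect dir kb c) U =
      g i c (torusConfigShift (v dir kb) (configPerm (π dir) (GaugeConfig.timeReflect (configPerm (π dir).symm
        (torusConfigShift (-(v dir kb)) U))))) := by
    intro i dir kb c U
    simp only [hg]
    rw [hMrefl, plane_torusLift_theta_swap r (N * B) dir (w dir kb) (hq i) (site i c) U,
      plane_torusLift_congr r (N * B) (q i) (hrefl i dir kb c) U]
  /- (4) measurability and boundedness -/
  have hgm : ∀ i c, Measurable (g i c) := fun i c =>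
    (continuous_plaquetteObs_torusLift r.ρ r.continuous (site i c) (q i).1 (q i).2).measurable.sub measurable_const
  have hMle : ∀ i c, |M i c| ≤ Cp := by
    intro i c
    simp only [hM]
    have h := norm_integral_le_of_norm_le_const (μ := μ)
      (f := fun V => plane G r (q i) (site i c) (torusLift (N * B) V)) (C := Cp)
      (Filter.Eventually.of_forall fun V => by rw [Real.norm_eq_abs]; exact hCp _ _ _)
    rw [probReal_univ, mul_one, Real.norm_eq_abs] at h
    exact h
  have hgb : ∀ i c, ∃ C : ℝ, ∀ U, |g i c U| ≤ C := fun i c => ⟨Cp + Cp, fun U => by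
    simp only [hg]
    exact (abs_sub _ _).trans (add_le_add (hCp _ _ _) (hMle i c))⟩
  /- (5) localisation: in-cell coordinates and the positive half -/
  have hcoord : ∀ i c (dir : Fin 4), ∃ u : ℕ, site i c dir = (((c dir).val : ℕ) : ℤ) * (B : ℤ) + (u : ℤ) ∧
      u + (if dir = (q i).1 ∨ dir = (q i).2 then 1 else 0) + 1 ≤ B := by
    intro i c dir
    have hpi := hp i dir
    rw [hsite]
    by_cases hev : Even (c dir).val
    · exact ⟨p i dir, by rw [if_pos hev], hpi⟩
    · refine ⟨B - 1 - p i dir - (if dir = (q i).1 ∨ dir = (q i).2 then 1 else 0), ?_, ?_⟩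
      · rw [if_neg hev]
        by_cases hχ : dir = (q i).1 ∨ dir = (q i).2
        · rw [if_pos hχ] at hpi ⊢; rw [if_pos hχ]; omega
        · rw [if_neg hχ] at hpi ⊢; rw [if_neg hχ]; omega
      · by_cases hχ : dir = (q i).1 ∨ dir = (q i).2
        · rw [if_pos hχ] at hpi ⊢; omega
        · rw [if_neg hχ] at hpi ⊢; omega
  have hwinZ : ∀ i c (dir : Fin 4) (kb : ZMod N), c ∈ halfPlus N dir kb → ∀ ξ : ℤ, 0 ≤ ξ →
      ξ ≤ (if dir = (q i).1 ∨ dir = (q i).2 then 1 else 0) →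
      1 ≤ ((((site i c dir + ξ : ℤ)) : ZMod (N * B)) - v dir kb dir).val ∧
        ((((site i c dir + ξ : ℤ)) : ZMod (N * B)) - v dir kb dir).val ≤ N * B / 2 := by
    intro i c dir kb hc ξ hξ0 hξ
    obtain ⟨ξn, rfl⟩ := Int.eq_ofNat_of_zero_le hξ0
    obtain ⟨u, hu, huB⟩ := hcoord i c dir
    rw [mem_halfPlus] at hc
    have hξB : u + ξn + 1 ≤ B := by
      by_cases hχ : dir = (q i).1 ∨ dir = (q i).2
      · rw [if_pos hχ] at hξ huB; omega
      · rw [if_neg hχ] at hξ huB; omega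
    have key := val_sub_boundary_pos (B := B) hN (c dir) kb hc (u + ξn) hξB
    have e : (((site i c dir + (ξn : ℤ) : ℤ)) : ZMod (N * B)) - v dir kb dir =
        (((((c dir).val : ℕ) : ℤ) * (B : ℤ) + ((u + ξn : ℕ) : ℤ) - ((((kb.val : ℕ) : ℤ)) * (B : ℤ) - 1) : ℤ) :
          ZMod (N * B)) := by
      rw [hv_dir, hu]; push_cast; ring
    rw [e]; exact key
  have hgdep : ∀ i c (dir : Fin 4) (kb : ZMod N), c ∈ halfPlus N dir kb → DependsOn (g i c)
      {e : Edge 4 (N * B) | WilsonRP.IsPosEdge ((sitePerm (π dir).symm (e.1 - v dir kb), (π dir).symm e.2) :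
        Edge 4 (N * B))} := by
    intro i c dir kb hc
    have hab : (q i).1 ≠ (q i).2 := ne_of_lt (hq i)
    have hdep := dependsOn_plaquetteObs_torusLift (S := N * B) r.ρ (site i c) (q i).1 (q i).2
    have W := hwinZ i c dir kb hc
    have hpos : ∀ (x : Fin 4 → ℤ) (a : Fin 4) (ξ : ℤ), x dir = site i c dir + ξ → 0 ≤ ξ →
        ξ + (if dir = a then 1 else 0) ≤ (if dir = (q i).1 ∨ dir = (q i).2 then 1 else 0) →
        WilsonRP.IsPosEdge ((sitePerm (π dir).symm ((torusEdge (N * B) (x, a)).1 - v dir kb),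
          (π dir).symm (torusEdge (N * B) (x, a)).2) : Edge 4 (N * B)) := by
      intro x a ξ hx hξ0 hξ
      have hia : (0 : ℤ) ≤ (if dir = a then 1 else 0) := by split_ifs <;> norm_num
      refine isPosEdge_perm_of_window (N * B) dir a (v dir kb) x ?_ ?_
      · rw [hx]; exact W ξ hξ0 (by linarith)
      · rw [hx, show site i c dir + ξ + (if dir = a then 1 else 0) = site i c dir + (ξ + if dir = a then 1 else 0) by ring]
        exact W _ (by linarith) hξ
    intro U V hUV
    simp only [hg]
    refine congrArg (fun t : ℝ => t - M i c) (hdep (fun e he => hUV e ?_))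
    simp only [Set.mem_insert_iff, Set.mem_singleton_iff] at he
    simp only [Set.mem_setOf_eq]
    have i1 : (if dir = (q i).1 then (1 : ℤ) else 0) ≤ (if dir = (q i).1 ∨ dir = (q i).2 then 1 else 0) := by
      by_cases h1 : dir = (q i).1
      · rw [if_pos h1, if_pos (Or.inl h1)]
      · rw [if_neg h1]; split_ifs <;> norm_num
    have i2 : (if dir = (q i).2 then (1 : ℤ) else 0) ≤ (if dir = (q i).1 ∨ dir = (q i).2 then 1 else 0) := by
      by_cases h2 : dir = (q i).2
      · rw [if_pos h2, if_pos (Or.inr h2)]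
      · rw [if_neg h2]; split_ifs <;> norm_num
    have i0a : (0 : ℤ) ≤ (if dir = (q i).1 then 1 else 0) := by split_ifs <;> norm_num
    have i0b : (0 : ℤ) ≤ (if dir = (q i).2 then 1 else 0) := by split_ifs <;> norm_num
    rcases he with rfl | rfl | rfl | rfl
    · exact hpos _ _ 0 (by simp) le_rfl (by simpa using i1)
    · exact hpos _ _ (if dir = (q i).1 then 1 else 0) (by simp [Pi.single_apply]) i0a (ind_add_ind_le hab)
    · refine hpos _ _ (if dir = (q i).2 then 1 else 0) (by simp [Pi.single_apply]) i0b ?_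
      rw [add_comm]; exact ind_add_ind_le hab
    · exact hpos _ _ 0 (by simp) le_rfl (by simpa using i2)
  /- (6) the chessboard estimate -/
  set Sc : Finset (Fin 4 → ZMod N) := Finset.univ.image cell with hSc
  set lab : (Fin 4 → ZMod N) → Fin n := Function.invFun cell with hlab_def
  have hCB := wilson_chessboard_integral_prod_subset_le r.ρ (d := 4) (by norm_num) hLeven r.continuous hβ hN π v g
    hgm hgb hgdep hgΘ Sc lab
  have hlab : ∀ i, lab (cell i) = i := Function.leftInverse_invFun hcell
  have hgY : ∀ i U, g i (cell i) U = plane G r (q i) (Y i) (torusLift (N * B) U) -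
      ∫ V, plane G r (q i) (Y i) (torusLift (N * B) V) ∂μ := by
    intro i U
    simp only [hg, hM]
    rw [plane_torusLift_congr r (N * B) (q i) (fun k => (hY i k).symm) U]
    congr 1
    exact integral_congr_ae (Filter.Eventually.of_forall fun V =>
      plane_torusLift_congr r (N * B) (q i) (fun k => (hY i k).symm) V)
  have hLHS : (fun U => ∏ c ∈ Sc, g (lab c) c U) = fun U => ∏ i, (plane G r (q i) (Y i) (torusLift (N * B) U) -
      ∫ V, plane G r (q i) (Y i) (torusLift (N * B) V) ∂μ) := by
    funext U
    rw [hSc, Finset.prod_image (fun i _ j _ h => hcell h)]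
    exact Finset.prod_congr rfl fun i _ => by rw [hlab, hgY]
  -- non-negativity of the arrays (the array is `⟨F·(F∘Θ)⟩` for the boundary `0` of direction `0`)
  have harr_nonneg : ∀ i, 0 ≤ ∫ U, ∏ c', g i c' U ∂μ := fun i =>
    Literature.Probability.LatticeModels.integral_array_nonneg μ (by norm_num : 0 < 4) hN Θ
      (fun dir kb => MeasurableSpace.comap (fun (U : GaugeConfig 4 (N * B) G)
        (e : {e : Edge 4 (N * B) | WilsonRP.IsPosEdge ((sitePerm (π dir).symm (e.1 - v dir kb),
          (π dir).symm e.2) : Edge 4 (N * B))}) => U e.1) MeasurableSpace.pi)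
      (fun dir kb F hF hFb => wilson_rp_comap r.ρ hLeven r.continuous hβ (π dir) (v dir kb) F hF hFb)
      g hgb (fun a c dir kb hc => measurable_comap_restrict_of_dependsOn _ (hgm a c) (hgdep a c dir kb hc)) hgΘ i
  have hroot : ∀ i, (∫ U, ∏ c', g i c' U ∂μ) ^ ((1 : ℝ) / (N : ℝ) ^ 4) ≤ A := by
    intro i
    have h1 : (∫ U, ∏ c', g i c' U ∂μ) ^ ((1 : ℝ) / (N : ℝ) ^ 4) ≤ (A ^ (N ^ 4)) ^ ((1 : ℝ) / (N : ℝ) ^ 4) :=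
      Real.rpow_le_rpow (harr_nonneg i) (harr i) (by positivity)
    have h2 : (A ^ (N ^ 4)) ^ ((1 : ℝ) / (N : ℝ) ^ 4) = A := by
      rw [show ((1 : ℝ) / (N : ℝ) ^ 4) = (((N ^ 4 : ℕ) : ℝ))⁻¹ by push_cast; rw [one_div]]
      exact Real.pow_rpow_inv_natCast hA (pow_ne_zero 4 (NeZero.ne N))
    rw [h2] at h1
    exact h1
  have hRHS : ∏ c ∈ Sc, (∫ U, ∏ c', g (lab c) c' U ∂μ) ^ ((1 : ℝ) / (N : ℝ) ^ 4) ≤ A ^ n := by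
    rw [hSc, Finset.prod_image (fun i _ j _ h => hcell h)]
    simp only [hlab]
    calc ∏ i, (∫ U, ∏ c', g i c' U ∂μ) ^ ((1 : ℝ) / (N : ℝ) ^ 4) ≤ ∏ _i : Fin n, A :=
          Finset.prod_le_prod (fun i _ => Real.rpow_nonneg (harr_nonneg i) _) (fun i _ => hroot i)
      _ = A ^ n := by simp
  rw [hLHS] at hCB
  exact hCB.trans hRHS


/-- **Translation invariance of the centred moments**: shifting all base points by a common `t ∈ ℤ⁴` does not
change `E ∏ᵢ (Pᵢ − E Pᵢ)` under Wilson's torus measure (`plane q (x + t) = plane q x ∘ θ_{−t}` and translation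
invariance of the lifted expectations). [folklore] -/
theorem integral_prod_centred_translate (L : ℕ) [NeZero L] (β : ℝ) {n : ℕ} (q : Fin n → Fin 4 × Fin 4)
    (x : Fin n → Fin 4 → ℤ) (t : Fin 4 → ℤ) :
    ∫ U, ∏ i, (plane G r (q i) (x i + t) (torusLift L U) -
        ∫ V, plane G r (q i) (x i + t) (torusLift L V) ∂(wilsonMeasure (d := 4) (L := L) r.ρ β))
        ∂(wilsonMeasure (d := 4) (L := L) r.ρ β) =
      ∫ U, ∏ i, (plane G r (q i) (x i) (torusLift L U) -
        ∫ V, plane G r (q i) (x i) (torusLift L V) ∂(wilsonMeasure (d := 4) (L := L) r.ρ β))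
        ∂(wilsonMeasure (d := 4) (L := L) r.ρ β) := by
  have hmean : ∀ i, ∫ V, plane G r (q i) (x i + t) (torusLift L V) ∂(wilsonMeasure (d := 4) (L := L) r.ρ β) =
      ∫ V, plane G r (q i) (x i) (torusLift L V) ∂(wilsonMeasure (d := 4) (L := L) r.ρ β) := by
    intro i
    simp_rw [Summit.QuantumFields.YangMills.Cruxes.OSLegsAtWeakCouplingC.InheritedAmplitudeGates.StubInherit.plane_add_apply
      G r (q i) (x i) t]
    exact Summit.QuantumFields.YangMills.Cruxes.OSLegsAtWeakCouplingC.InheritedAmplitudeGates.StubInherit.integral_lift_configShift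
      G r L β (-t) (fun W => plane G r (q i) (x i) W)
  simp_rw [hmean, Summit.QuantumFields.YangMills.Cruxes.OSLegsAtWeakCouplingC.InheritedAmplitudeGates.StubInherit.plane_add_apply
    G r _ _ t]
  exact Summit.QuantumFields.YangMills.Cruxes.OSLegsAtWeakCouplingC.InheritedAmplitudeGates.StubInherit.integral_lift_configShift
    G r L β (-t) (fun W => ∏ i, (plane G r (q i) (x i) W -
      ∫ V, plane G r (q i) (x i) (torusLift L V) ∂(wilsonMeasure (d := 4) (L := L) r.ρ β)))

/-- **The trivial bound**: `|E ∏ᵢ (Pᵢ − E Pᵢ)| ≤ (2 C_P)ⁿ` when `|plane| ≤ C_P`. [folklore] -/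
theorem abs_integral_prod_centred_le_pow (L : ℕ) [NeZero L] (β : ℝ) {n : ℕ} (q : Fin n → Fin 4 × Fin 4)
    (x : Fin n → Fin 4 → ℤ) {Cp : ℝ} (hCp : ∀ (q : Fin 4 × Fin 4) (y : Fin 4 → ℤ) (U : LGConfig 4 G), |plane G r q y U| ≤ Cp) :
    |∫ U, ∏ i, (plane G r (q i) (x i) (torusLift L U) -
        ∫ V, plane G r (q i) (x i) (torusLift L V) ∂(wilsonMeasure (d := 4) (L := L) r.ρ β))
        ∂(wilsonMeasure (d := 4) (L := L) r.ρ β)| ≤ (2 * Cp) ^ n := by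
  set μ := wilsonMeasure (d := 4) (L := L) r.ρ β with hμ
  haveI : IsProbabilityMeasure μ := isProbabilityMeasure_wilsonMeasure _ r.continuous β
  have hmean : ∀ i, |∫ V, plane G r (q i) (x i) (torusLift L V) ∂μ| ≤ Cp := by
    intro i
    have h := norm_integral_le_of_norm_le_const (μ := μ)
      (f := fun V => plane G r (q i) (x i) (torusLift L V)) (C := Cp)
      (Filter.Eventually.of_forall fun V => by rw [Real.norm_eq_abs]; exact hCp _ _ _)
    rw [probReal_univ, mul_one, Real.norm_eq_abs] at h
    exact h
  have h := norm_integral_le_of_norm_le_const (μ := μ)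
    (f := fun U => ∏ i, (plane G r (q i) (x i) (torusLift L U) - ∫ V, plane G r (q i) (x i) (torusLift L V) ∂μ))
    (C := (2 * Cp) ^ n) (Filter.Eventually.of_forall fun U => by
      rw [Real.norm_eq_abs, Finset.abs_prod]
      calc ∏ i, |plane G r (q i) (x i) (torusLift L U) - ∫ V, plane G r (q i) (x i) (torusLift L V) ∂μ|
          ≤ ∏ _i : Fin n, (2 * Cp) := Finset.prod_le_prod (fun i _ => abs_nonneg _) fun i _ =>
            (abs_sub _ _).trans (by linarith [hCp (q i) (x i) (torusLift L U), hmean i])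
        _ = (2 * Cp) ^ n := by simp)
  rw [probReal_univ, mul_one, Real.norm_eq_abs] at h
  exact h

end Summit.QuantumFields.YangMills.Theorems.DyadicChessboard.Transfer

end
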